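import Literature.NumberTheory.IwasawaTheory.Greenberg2016.DualShaTorsionOfShaDualityTower
import Literature.NumberTheory.IwasawaTheory.Greenberg2016.ShaRestrictedBridges
import Literature.NumberTheory.GaloisCohomology.PoitouTateRestrictedRamificationNatural
import Literature.NumberTheory.GaloisRepresentations.ContinuousCohomologyDivisibleSequence
import HarnessLib

/-!
# The tower of restricted Ш-dualities on Greenberg's `𝐃[𝔪ᵏ]`-tower FROM the natural Poitou–Tate
# Ш-duality (Milne ADT I 4.10 (a), named fact), and (γ) of Greenberg 2010 Prop. 3.2.1 (theorems only)

Topic `NumberTheory/IwasawaTheory/Greenberg2016`; namespace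
`Literature.NumberTheory.IwasawaTheory.Greenberg2016`; three definitions WITH BODIES (`torsionLevelRep`, `levelPairing`,
`towerPairing`) and theorems (no named fact, no `sorry`, no instance).  Lane «SUR-Λ» of cell `bsd-eis` (road memo `SUR-LAMBDA-ROAD-w5g9.md` §8,
brick C7b part 6 = the consumer of the D-ii named fact
`poitouTate_shaRestricted_tateDual_natural`), `--supports stmt-BirchSwinnertonDyer-19032`.

Given a family `B n M σ : Ш²_S(K, M) × Ш¹_S(K, M^D) → ℚ/ℤ` as in the named fact — (P) perfect under
the hypotheses of Milne I 4.10 (a), (N) natural for adjoint pairs `(F, G)` of module maps — the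
level pairings of Greenberg's tower `D_k = 𝐃[𝔪ᵏ]` (`E := torsionLayers ρ e hD`,
`ρ_k := ρ|_{𝐃[𝔪ᵏ]}`, `E.layerDualRep k = (toGaloisModule S ρ_k)^D (p^k)` definitionally) are
`b k x z := B (p^k) 𝐃[𝔪ᵏ] (toGaloisModule S ρ_k) (e₂⁻¹ x) (e₁⁻¹ z)` through the bridges
`e₂ = sha2RestrictedEquiv`, `e₁ = shaOneRestrictedEquiv` (`ShaRestrictedBridges`).  Then:

* `towerPairing_natural` — (N) at `(F, G) = (D_k ⊆ D_m, res)` gives `IsShaDualityTower.natural`;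
* `towerPairing_smul` — (N) at `(F, G) = (r, r̂_k)` gives the `Λ`-balance `hDb₂`;
* `towerPairing_nondegenerate` — (P) (`Bijective (B …).flip`) gives `hDa`;
* **`dualSha_torsion_of_poitouTateNatural`** — with `dualSha_torsion_of_shaDualityTower`:
  `poitouTate_shaRestricted_tateDual_natural K` + `LEO S ρ` ⇒ every `y ∈ dualSha ρ e hD inv` is
  killed by `H¹(θ̂_r)` for some `r ≠ 0` (the `hSha` of `Specification.sur_of_dualSelmer_inputs`),
  GRANTED two bookkeeping hypotheses discharged elsewhere: the dual layers are unramified outside `S`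
  (`hurD`) and the cardinalities `#𝐃[𝔪ᵏ]` are supported on `S` (`hcard`).

HONESTY: the Ш-duality itself is the named fact (an INPUT); no case of Greenberg's propositions and
nothing about BSD is proved here.  AI formalisation, weaker than expert review; the statements are
established only by the kernel check.

## References
* R. Greenberg, *Surjectivity of the global-to-local map defining a Selmer group*, Kyoto J. Math.
  50 (2010) 853–888, §2.1 (6)–(7) p. 7, proof of Prop. 3.2.1 p. 15. [Greenberg2010]
* J. S. Milne, *Arithmetic Duality Theorems*, 2nd ed. (2006), I Thm. 4.10 (a) and §4 p. 65. [MilneADT2006]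
-/

noncomputable section

open scoped Classical
open Function CategoryTheory NumberField IsDedekindDomain Field IsLocalRing
open _root_.TopRep _root_.ContRepresentation _root_.ContinuousCohomology
open Literature.NumberTheory.GaloisRepresentations
open Literature.NumberTheory.GaloisRepresentations.DiscreteGaloisModule
open Literature.NumberTheory.GaloisRepresentations.DiscreteGaloisModule.TorsionLayers
open Literature.NumberTheory.GaloisCohomology
open Literature.NumberTheory.IwasawaTheory.Greenberg2006

namespace Literature.NumberTheory.IwasawaTheory.Greenberg2016

variable {K : Type} [Field K] [NumberField K] {S : Set (HeightOneSpectrum (𝓞 K))}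
  {Λ : Type} [CommRing Λ] [TopologicalSpace Λ]
  {D : Type} [AddCommGroup D] [Module Λ D] [TopologicalSpace D] [DiscreteTopology D]
  [ContinuousSMul Λ D]
  (ρ : ContinuousRep (GaloisGroupUnramifiedOutside K S) Λ D)

/-! ### The levels `ρ_k = ρ|_{𝐃[𝔪ᵏ]}` -/

/-- **`ρ_k := ρ|_{𝐃[𝔪ᵏ]}`**, Greenberg's representation on the `Λ`-submodule `𝐃[𝔪ᵏ]` (the tree's
`ρ.subrepresentation` at `torsionBySet_maximalIdeal_pow_le_comap`; `(torsionLayers ρ e hD).layerRep k`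
is `toGaloisModule S (torsionLevelRep ρ k)` definitionally, `layerRep_torsionLayers`).
[cite: Greenberg2010, §2 p. 6 L1–12] -/
def torsionLevelRep [IsLocalRing Λ] (k : ℕ) :
    ContinuousRep (GaloisGroupUnramifiedOutside K S) Λ ↥(Submodule.torsionBySet Λ D ((maximalIdeal Λ ^ k : Ideal Λ) : Set Λ)) :=
  ρ.subrepresentation (Submodule.torsionBySet Λ D ((maximalIdeal Λ ^ k : Ideal Λ) : Set Λ)) (torsionBySet_maximalIdeal_pow_le_comap ρ k)

omit [NumberField K] [DiscreteTopology D] [ContinuousSMul Λ D] in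
/-- Unfolding `torsionLevelRep`. [cite: Greenberg2010, §2 p. 6 L1–12] -/
theorem torsionLevelRep_eq [IsLocalRing Λ] (k : ℕ) :
    torsionLevelRep ρ k = ρ.subrepresentation (Submodule.torsionBySet Λ D ((maximalIdeal Λ ^ k : Ideal Λ) : Set Λ)) (torsionBySet_maximalIdeal_pow_le_comap ρ k) :=
  rfl

omit [NumberField K] in
/-- `Hmap` of the scalar `r` is multiplication by `r` on `Hⁿ(K_Σ/K, ·)` (the tree's
`cohomologyMap_eq_smul_of_forall`). [cite: Greenberg2010, §2 p. 6 L5–8] -/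
theorem Hmap_lsmul_eq_smul {A : Type} [AddCommGroup A] [Module Λ A] [TopologicalSpace A]
    [DiscreteTopology A] [ContinuousSMul Λ A] (τ : ContinuousRep (GaloisGroupUnramifiedOutside K S) Λ A)
    (r : Λ) (n : ℕ) (x : τ.H n) :
    Hmap τ τ ⟨LinearMap.lsmul Λ A r, continuous_of_discreteTopology⟩
        (fun g a => ((τ g).map_smul r a).symm) n x = r • x :=
  ContinuousRep.cohomologyMap_eq_smul_of_forall (ρ := τ) r
    (TopRep.ofHom ⟨⟨LinearMap.lsmul Λ A r, continuous_of_discreteTopology⟩, fun g => by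
      ext a; exact ((τ g).map_smul r a).symm⟩) (fun _ => rfl) n x

variable {p : ℕ} [Fact p.Prime] {m : ℕ} [IsLocalRing Λ]
  (e : Λ ≃+* MvPowerSeries (Fin m) ℤ_[p]) (hD : IsCofinitelyGenerated Λ D)

/-! ### The two adjoint pairs: (inclusion, restriction) and (`r`, `r̂_k`) -/

omit [NumberField K] [ContinuousSMul Λ D] in
/-- `(res φ')(d) = φ'(d)` on unit values, for the transition `Hom(D_l, μ) → Hom(D_k, μ)` and the
inclusion `D_k ⊆ D_l` (definitional). [cite: Greenberg2010, §2 p. 6 L1–12] -/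
theorem uval_redHom_hom {k l : ℕ} (h : k ≤ l) (φ' : (torsionLayers ρ e hD).LayerDual l) (d : ↥(Submodule.torsionBySet Λ D ((maximalIdeal Λ ^ k : Ideal Λ) : Set Λ))) :
    (torsionLayers ρ e hD).uval (((torsionLayers ρ e hD).dualSystem.redHom h).hom φ') d =
      (torsionLayers ρ e hD).uval φ' ((toGaloisModuleHom S (torsionLevelRep ρ k) (torsionLevelRep ρ l) ⟨Submodule.inclusion (torsionBySet_maximalIdeal_pow_mono h), continuous_of_discreteTopology⟩ (fun _ _ ↦ rfl)).hom d) :=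
  rfl

omit [NumberField K] [ContinuousSMul Λ D] in
/-- `(r̂_k φ')(d) = φ'(r d)` on unit values (definitional). [cite: Greenberg2010, §2 p. 6 L5–8] -/
theorem uval_layerDualEndHom_hom (k : ℕ) (r : Λ) (φ' : (torsionLayers ρ e hD).LayerDual k) (d : ↥(Submodule.torsionBySet Λ D ((maximalIdeal Λ ^ k : Ideal Λ) : Set Λ))) :
    (torsionLayers ρ e hD).uval (((torsionLayers ρ e hD).layerDualEndHom (DistribSMul.toAddMonoidHom D r) (fun k d hd => smul_mem_torsionLayers ρ e hD k r d hd) (smul_toDiscreteGaloisModule_comm ρ r) k).hom φ') d =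
      (torsionLayers ρ e hD).uval φ' ((toGaloisModuleHom S (torsionLevelRep ρ k) (torsionLevelRep ρ k) ⟨LinearMap.lsmul Λ ↥(Submodule.torsionBySet Λ D ((maximalIdeal Λ ^ k : Ideal Λ) : Set Λ)) r, continuous_of_discreteTopology⟩ (fun g a => (((torsionLevelRep ρ k) g).map_smul r a).symm)).hom d) :=
  rfl

section WithFamily

variable [∀ k : ℕ, Finite ↥(Submodule.torsionBySet Λ D ((maximalIdeal Λ ^ k : Ideal Λ) : Set Λ))]
  (B : ∀ (n : ℕ) (M : Type) [AddCommGroup M] [TopologicalSpace M] [DiscreteTopology M] [Finite M]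
    (σ : DiscreteGaloisModule K M),
    ↥(shaRestricted σ S 2) →+ ↥(shaRestricted (σ.tateDual n) S 1) →+ AddCircle (1 : ℚ))

/-! ### The level pairings -/

set_option maxHeartbeats 400000 in
/-- **`B` at the level `k`**: `B (p^k) 𝐃[𝔪ᵏ] (toGaloisModule S ρ_k)`, with its second argument READ
in the currency of the dual tower (`(torsionLayers ρ e hD).layerDualRep k`, the same module
definitionally — the one place where this identification is made). [cite: Greenberg2010, §2.1 (6) p. 7] -/
def levelPairing (k : ℕ) :
    ↥(shaRestricted (toGaloisModule S (torsionLevelRep ρ k)) S 2) →+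
      ↥(shaRestricted ((torsionLayers ρ e hD).layerDualRep k) S 1) →+ AddCircle (1 : ℚ) :=
  B (p ^ k) ↥(Submodule.torsionBySet Λ D ((maximalIdeal Λ ^ k : Ideal Λ) : Set Λ)) (toGaloisModule S (torsionLevelRep ρ k))

variable (hurD : ∀ k, GaloisRep.IsUnramifiedOutside S ((torsionLayers ρ e hD).layerDualRep k))

/-- **The level pairing `b_k : Ш²(K, Σ, 𝐃[𝔪ᵏ]) × Ш¹ᴰ_k → ℚ/ℤ`** read off `B` through the bridges
`sha2RestrictedEquiv` / `shaOneRestrictedEquiv`. [cite: Greenberg2010, §2.1 (6) p. 7]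
[cite: MilneADT2006, Ch. I, Thm. 4.10 (a)] -/
def towerPairing (k : ℕ) :
    ↥(sha2 S (torsionLevelRep ρ k)) →+ ↥(shaOneDualLevel S (torsionLayers ρ e hD) k) →+ AddCircle (1 : ℚ) :=
  AddMonoidHom.compl₂ ((levelPairing ρ e hD B k).comp
      (sha2RestrictedEquiv S (torsionLevelRep ρ k)).symm.toAddMonoidHom)
    (shaOneRestrictedEquiv S (torsionLayers ρ e hD) k (hurD k)).symm.toAddMonoidHom

/-- Unfolding `towerPairing`: `b_k x z = B_k (e₂⁻¹ x) (e₁⁻¹ z)`. [cite: Greenberg2010, §2.1 (6) p. 7] -/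
theorem towerPairing_apply (k : ℕ) (x : ↥(sha2 S (torsionLevelRep ρ k))) (z : ↥(shaOneDualLevel S (torsionLayers ρ e hD) k)) :
    towerPairing ρ e hD B hurD k x z =
      levelPairing ρ e hD B k ((sha2RestrictedEquiv S (torsionLevelRep ρ k)).symm x)
        ((shaOneRestrictedEquiv S (torsionLayers ρ e hD) k (hurD k)).symm z) :=
  rfl

/-! ### (N) ⟹ naturality along the tower and `Λ`-balance; (P) ⟹ non-degeneracy -/

/-- **Naturality of the level pairings along `𝐃[𝔪ᵏ] ⊆ 𝐃[𝔪ˡ]`** (`k ≤ l`):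
`b_l((D_k ⊆ D_l)_* x, z) = b_k(x, res z)` — clause (N) of the named fact (specialised to the two
levels, `levelPairing` currency) at the adjoint pair `(inclusion, restriction)`, transported through
the bridges (`sha2RestrictedEquiv_symm_Hmap`, `shaOneRestrictedEquiv_symm_cohomologyMap`).
[cite: MilneADT2006, Ch. I §4 p. 65] [cite: Greenberg2010, §2.1 (6) p. 7] -/
theorem towerPairing_natural {k l : ℕ} (h : k ≤ l)
    (hN : ∀ (F : (toGaloisModule S (torsionLevelRep ρ k)).toTopRep ⟶ (toGaloisModule S (torsionLevelRep ρ l)).toTopRep)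
        (G : ((torsionLayers ρ e hD).layerDualRep l).toTopRep ⟶ ((torsionLayers ρ e hD).layerDualRep k).toTopRep),
        (∀ (φ' : (torsionLayers ρ e hD).LayerDual l) (d : ↥(Submodule.torsionBySet Λ D ((maximalIdeal Λ ^ k : Ideal Λ) : Set Λ))),
            (torsionLayers ρ e hD).uval (G.hom φ') d = (torsionLayers ρ e hD).uval φ' (F.hom d)) →
        ∀ (x : ↥(shaRestricted (toGaloisModule S (torsionLevelRep ρ k)) S 2))
          (x' : ↥(shaRestricted (toGaloisModule S (torsionLevelRep ρ l)) S 2)),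
          (x'.1 : _) = (ContinuousCohomology.map (ContinuousMonoidHom.id (GaloisGroupUnramifiedOutside K S))
              (ContinuousRep.invariantsHom (N := ramificationSubgroup K S) F) 2).hom x.1 →
          ∀ (z' : ↥(shaRestricted ((torsionLayers ρ e hD).layerDualRep l) S 1))
            (z : ↥(shaRestricted ((torsionLayers ρ e hD).layerDualRep k) S 1)),
            (z.1 : _) = (ContinuousCohomology.map (ContinuousMonoidHom.id (GaloisGroupUnramifiedOutside K S))
                (ContinuousRep.invariantsHom (N := ramificationSubgroup K S) G) 1).hom z'.1 →
            levelPairing ρ e hD B l x' z' = levelPairing ρ e hD B k x z)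
    (x : ↥(sha2 S (torsionLevelRep ρ k))) (z : ↥(shaOneDualLevel S (torsionLayers ρ e hD) l)) :
    towerPairing ρ e hD B hurD l
        ⟨Hmap (torsionLevelRep ρ k) (torsionLevelRep ρ l) ⟨Submodule.inclusion (torsionBySet_maximalIdeal_pow_mono h),
            continuous_of_discreteTopology⟩ (fun _ _ ↦ rfl) 2 x.1,
          Hmap_inclusion_mem_sha2 (ρ := ρ) (torsionBySet_maximalIdeal_pow_le_comap ρ)
            torsionBySet_maximalIdeal_pow_mono h x.2⟩ z =
      towerPairing ρ e hD B hurD k x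
        ⟨cohomologyMap ((torsionLayers ρ e hD).dualSystem.redHom h) 1 z.1, redHom_mem_shaOneDualLevel S (torsionLayers ρ e hD) h z.2⟩ := by
  rw [towerPairing_apply, towerPairing_apply]
  exact hN (toGaloisModuleHom S (torsionLevelRep ρ k) (torsionLevelRep ρ l) ⟨Submodule.inclusion (torsionBySet_maximalIdeal_pow_mono h), continuous_of_discreteTopology⟩ (fun _ _ ↦ rfl)) ((torsionLayers ρ e hD).dualSystem.redHom h) (uval_redHom_hom ρ e hD h)
    ((sha2RestrictedEquiv S (torsionLevelRep ρ k)).symm x)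
    ((sha2RestrictedEquiv S (torsionLevelRep ρ l)).symm ⟨_, Hmap_inclusion_mem_sha2 (ρ := ρ)
      (torsionBySet_maximalIdeal_pow_le_comap ρ) torsionBySet_maximalIdeal_pow_mono h x.2⟩)
    (sha2RestrictedEquiv_symm_Hmap S (torsionLevelRep ρ k) (torsionLevelRep ρ l) _ _ x _)
    ((shaOneRestrictedEquiv S (torsionLayers ρ e hD) l (hurD l)).symm z)
    ((shaOneRestrictedEquiv S (torsionLayers ρ e hD) k (hurD k)).symm
      ⟨cohomologyMap ((torsionLayers ρ e hD).dualSystem.redHom h) 1 z.1, redHom_mem_shaOneDualLevel S (torsionLayers ρ e hD) h z.2⟩)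
    (shaOneRestrictedEquiv_symm_cohomologyMap S (torsionLayers ρ e hD) (hurD k) (hurD l) _ z)

/-- **`Λ`-balance of the level pairings**: `b_k(r x, z) = b_k(x, r̂_k z)` — clause (N) at the adjoint
pair `(r, r̂_k)`, with `Hmap r = r •` on `H²` (`Hmap_lsmul_eq_smul`). [cite: MilneADT2006, Ch. I §4 p. 65]
[cite: Greenberg2010, §2.1 (6)–(7) p. 7] -/
theorem towerPairing_smul (k : ℕ) (r : Λ)
    (hN : ∀ (F : (toGaloisModule S (torsionLevelRep ρ k)).toTopRep ⟶ (toGaloisModule S (torsionLevelRep ρ k)).toTopRep)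
        (G : ((torsionLayers ρ e hD).layerDualRep k).toTopRep ⟶ ((torsionLayers ρ e hD).layerDualRep k).toTopRep),
        (∀ (φ' : (torsionLayers ρ e hD).LayerDual k) (d : ↥(Submodule.torsionBySet Λ D ((maximalIdeal Λ ^ k : Ideal Λ) : Set Λ))),
            (torsionLayers ρ e hD).uval (G.hom φ') d = (torsionLayers ρ e hD).uval φ' (F.hom d)) →
        ∀ (x : ↥(shaRestricted (toGaloisModule S (torsionLevelRep ρ k)) S 2))
          (x' : ↥(shaRestricted (toGaloisModule S (torsionLevelRep ρ k)) S 2)),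
          (x'.1 : _) = (ContinuousCohomology.map (ContinuousMonoidHom.id (GaloisGroupUnramifiedOutside K S))
              (ContinuousRep.invariantsHom (N := ramificationSubgroup K S) F) 2).hom x.1 →
          ∀ (z' : ↥(shaRestricted ((torsionLayers ρ e hD).layerDualRep k) S 1))
            (z : ↥(shaRestricted ((torsionLayers ρ e hD).layerDualRep k) S 1)),
            (z.1 : _) = (ContinuousCohomology.map (ContinuousMonoidHom.id (GaloisGroupUnramifiedOutside K S))
                (ContinuousRep.invariantsHom (N := ramificationSubgroup K S) G) 1).hom z'.1 →
            levelPairing ρ e hD B k x' z' = levelPairing ρ e hD B k x z)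
    (x : ↥(sha2 S (torsionLevelRep ρ k))) (z : ↥(shaOneDualLevel S (torsionLayers ρ e hD) k)) :
    towerPairing ρ e hD B hurD k ⟨r • x.1, Submodule.smul_mem _ r x.2⟩ z =
      towerPairing ρ e hD B hurD k x
        ⟨cohomologyMap ((torsionLayers ρ e hD).layerDualEndHom (DistribSMul.toAddMonoidHom D r) (fun k d hd => smul_mem_torsionLayers ρ e hD k r d hd) (smul_toDiscreteGaloisModule_comm ρ r) k) 1 z.1,
          cohomologyMap_mem_shaOneDualLevel S (torsionLayers ρ e hD) ((torsionLayers ρ e hD).layerDualEndHom (DistribSMul.toAddMonoidHom D r) (fun k d hd => smul_mem_torsionLayers ρ e hD k r d hd) (smul_toDiscreteGaloisModule_comm ρ r) k) z.2⟩ := by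
  -- `r • x = Hmap r x`
  have hmem : Hmap (torsionLevelRep ρ k) (torsionLevelRep ρ k) ⟨LinearMap.lsmul Λ ↥(Submodule.torsionBySet Λ D ((maximalIdeal Λ ^ k : Ideal Λ) : Set Λ)) r, continuous_of_discreteTopology⟩
      (fun g a => (((torsionLevelRep ρ k) g).map_smul r a).symm) 2 x.1 ∈ sha2 S (torsionLevelRep ρ k) := by
    rw [Hmap_lsmul_eq_smul]
    exact Submodule.smul_mem _ r x.2
  have hx : (⟨r • x.1, Submodule.smul_mem _ r x.2⟩ : ↥(sha2 S (torsionLevelRep ρ k))) = ⟨_, hmem⟩ :=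
    Subtype.ext (Hmap_lsmul_eq_smul (torsionLevelRep ρ k) r 2 x.1).symm
  rw [hx, towerPairing_apply, towerPairing_apply]
  exact hN (toGaloisModuleHom S (torsionLevelRep ρ k) (torsionLevelRep ρ k) ⟨LinearMap.lsmul Λ ↥(Submodule.torsionBySet Λ D ((maximalIdeal Λ ^ k : Ideal Λ) : Set Λ)) r, continuous_of_discreteTopology⟩ (fun g a => (((torsionLevelRep ρ k) g).map_smul r a).symm)) ((torsionLayers ρ e hD).layerDualEndHom (DistribSMul.toAddMonoidHom D r) (fun k d hd => smul_mem_torsionLayers ρ e hD k r d hd) (smul_toDiscreteGaloisModule_comm ρ r) k) (uval_layerDualEndHom_hom ρ e hD k r)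
    ((sha2RestrictedEquiv S (torsionLevelRep ρ k)).symm x)
    ((sha2RestrictedEquiv S (torsionLevelRep ρ k)).symm ⟨_, hmem⟩)
    (sha2RestrictedEquiv_symm_Hmap S (torsionLevelRep ρ k) (torsionLevelRep ρ k) _ _ x _)
    ((shaOneRestrictedEquiv S (torsionLayers ρ e hD) k (hurD k)).symm z)
    ((shaOneRestrictedEquiv S (torsionLayers ρ e hD) k (hurD k)).symm
      ⟨cohomologyMap ((torsionLayers ρ e hD).layerDualEndHom (DistribSMul.toAddMonoidHom D r) (fun k d hd => smul_mem_torsionLayers ρ e hD k r d hd) (smul_toDiscreteGaloisModule_comm ρ r) k) 1 z.1, cohomologyMap_mem_shaOneDualLevel S (torsionLayers ρ e hD) ((torsionLayers ρ e hD).layerDualEndHom (DistribSMul.toAddMonoidHom D r) (fun k d hd => smul_mem_torsionLayers ρ e hD k r d hd) (smul_toDiscreteGaloisModule_comm ρ r) k) z.2⟩)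
    (shaOneRestrictedEquiv_symm_cohomologyMap S (torsionLayers ρ e hD) (hurD k) (hurD k) _ z)

set_option maxHeartbeats 400000 in
/-- **Right non-degeneracy of the level pairings** from clause (P) (`Bijective (B …).flip`): if
`b_k(x, z) = 0` for all `x ∈ Ш²(K, Σ, 𝐃[𝔪ᵏ])` then `z = 0`. [cite: MilneADT2006, Ch. I, Thm. 4.10 (a)] -/
theorem towerPairing_nondegenerate (k : ℕ) (hP : Injective (levelPairing ρ e hD B k).flip)
    (z : ↥(shaOneDualLevel S (torsionLayers ρ e hD) k)) (hz : ∀ x, towerPairing ρ e hD B hurD k x z = 0) : z = 0 := by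
  have h1 : (levelPairing ρ e hD B k).flip ((shaOneRestrictedEquiv S (torsionLayers ρ e hD) k (hurD k)).symm z) = 0 := by
    refine AddMonoidHom.ext fun x₀ => ?_
    rw [AddMonoidHom.flip_apply, AddMonoidHom.zero_apply]
    have h := hz (sha2RestrictedEquiv S (torsionLevelRep ρ k) x₀)
    rw [towerPairing_apply, AddEquiv.symm_apply_apply] at h
    exact h
  have h0 : (shaOneRestrictedEquiv S (torsionLayers ρ e hD) k (hurD k)).symm z = 0 :=
    ((injective_iff_map_eq_zero' _).1 hP _).1 h1
  have hz0 := congrArg (shaOneRestrictedEquiv S (torsionLayers ρ e hD) k (hurD k)) h0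
  rwa [AddEquiv.apply_symm_apply, map_zero] at hz0

/-! ### From the named fact's clauses to the `levelPairing` currency -/

omit [ContinuousSMul Λ D] in
/-- **Clause (N) at the levels `(k, l)`, read in the currency of the dual tower** (the modules
`(toGaloisModule S ρ_k)^D (p^k)` and `(torsionLayers ρ e hD).layerDualRep k` agree definitionally, and
`uval` is the unit value of the named fact's adjointness condition). [cite: MilneADT2006, Ch. I §4 p. 65] -/
theorem levelPairing_natural_of_fact (k l : ℕ)
    (hN : ∀ (F : (toGaloisModule S (torsionLevelRep ρ k)).toTopRep ⟶ (toGaloisModule S (torsionLevelRep ρ l)).toTopRep)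
        (G : ((toGaloisModule S (torsionLevelRep ρ l)).tateDual (p ^ l)).toTopRep ⟶ ((toGaloisModule S (torsionLevelRep ρ k)).tateDual (p ^ k)).toTopRep),
        (∀ (φ' : TateDual K ↥(Submodule.torsionBySet Λ D ((maximalIdeal Λ ^ l : Ideal Λ) : Set Λ)) (p ^ l)) (d : ↥(Submodule.torsionBySet Λ D ((maximalIdeal Λ ^ k : Ideal Λ) : Set Λ))),
            ((Additive.toMul (G.hom φ' d) : rootsOfUnity (p ^ k) (AlgebraicClosure K)) :
                (AlgebraicClosure K)ˣ) =
              ((Additive.toMul (φ' (F.hom d)) : rootsOfUnity (p ^ l) (AlgebraicClosure K)) :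
                (AlgebraicClosure K)ˣ)) →
        ∀ (x : ↥(shaRestricted (toGaloisModule S (torsionLevelRep ρ k)) S 2)) (x' : ↥(shaRestricted (toGaloisModule S (torsionLevelRep ρ l)) S 2)),
          (x' : restrictedCohomology (toGaloisModule S (torsionLevelRep ρ l)) S 2) =
            (ContinuousCohomology.map (ContinuousMonoidHom.id (GaloisGroupUnramifiedOutside K S))
              (ContinuousRep.invariantsHom (N := ramificationSubgroup K S) F) 2).hom
              (x : restrictedCohomology (toGaloisModule S (torsionLevelRep ρ k)) S 2) →
          ∀ (z' : ↥(shaRestricted ((toGaloisModule S (torsionLevelRep ρ l)).tateDual (p ^ l)) S 1))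
            (z : ↥(shaRestricted ((toGaloisModule S (torsionLevelRep ρ k)).tateDual (p ^ k)) S 1)),
            (z : restrictedCohomology ((toGaloisModule S (torsionLevelRep ρ k)).tateDual (p ^ k)) S 1) =
              (ContinuousCohomology.map (ContinuousMonoidHom.id (GaloisGroupUnramifiedOutside K S))
                (ContinuousRep.invariantsHom (N := ramificationSubgroup K S) G) 1).hom
                (z' : restrictedCohomology ((toGaloisModule S (torsionLevelRep ρ l)).tateDual (p ^ l)) S 1) →
            B (p ^ l) ↥(Submodule.torsionBySet Λ D ((maximalIdeal Λ ^ l : Ideal Λ) : Set Λ)) (toGaloisModule S (torsionLevelRep ρ l)) x' z' = B (p ^ k) ↥(Submodule.torsionBySet Λ D ((maximalIdeal Λ ^ k : Ideal Λ) : Set Λ)) (toGaloisModule S (torsionLevelRep ρ k)) x z) :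
    ∀ (F : (toGaloisModule S (torsionLevelRep ρ k)).toTopRep ⟶ (toGaloisModule S (torsionLevelRep ρ l)).toTopRep)
        (G : ((torsionLayers ρ e hD).layerDualRep l).toTopRep ⟶ ((torsionLayers ρ e hD).layerDualRep k).toTopRep),
        (∀ (φ' : (torsionLayers ρ e hD).LayerDual l) (d : ↥(Submodule.torsionBySet Λ D ((maximalIdeal Λ ^ k : Ideal Λ) : Set Λ))),
            (torsionLayers ρ e hD).uval (G.hom φ') d = (torsionLayers ρ e hD).uval φ' (F.hom d)) →
        ∀ (x : ↥(shaRestricted (toGaloisModule S (torsionLevelRep ρ k)) S 2))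
          (x' : ↥(shaRestricted (toGaloisModule S (torsionLevelRep ρ l)) S 2)),
          (x'.1 : _) = (ContinuousCohomology.map (ContinuousMonoidHom.id (GaloisGroupUnramifiedOutside K S))
              (ContinuousRep.invariantsHom (N := ramificationSubgroup K S) F) 2).hom x.1 →
          ∀ (z' : ↥(shaRestricted ((torsionLayers ρ e hD).layerDualRep l) S 1))
            (z : ↥(shaRestricted ((torsionLayers ρ e hD).layerDualRep k) S 1)),
            (z.1 : _) = (ContinuousCohomology.map (ContinuousMonoidHom.id (GaloisGroupUnramifiedOutside K S))
                (ContinuousRep.invariantsHom (N := ramificationSubgroup K S) G) 1).hom z'.1 →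
            levelPairing ρ e hD B l x' z' = levelPairing ρ e hD B k x z :=
  fun F G hadj x x' hxx' z' z hzz' => hN F G hadj x x' hxx' z' z hzz'

omit [ContinuousSMul Λ D] in
/-- **Clause (P) at the level `k`** (`Bijective (B …).flip`), read in the currency of the dual tower.
[cite: MilneADT2006, Ch. I, Thm. 4.10 (a)] -/
theorem levelPairing_flip_injective_of_fact (k : ℕ)
    (hP : Bijective (B (p ^ k) ↥(Submodule.torsionBySet Λ D ((maximalIdeal Λ ^ k : Ideal Λ) : Set Λ)) (toGaloisModule S (torsionLevelRep ρ k))).flip) :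
    Injective (levelPairing ρ e hD B k).flip :=
  hP.1

end WithFamily

/-! ### (γ) from the named fact -/

/-- **`Ш¹(K, Σ, T*)` is `Λ`-torsion under `LEO(𝐃)`, from the natural restricted Poitou–Tate
Ш-duality** (the tree's named fact `poitouTate_shaRestricted_tateDual_natural`, Milne ADT I
Thm. 4.10 (a) with the functoriality of its pairing): for every `y ∈ dualSha ρ e hD inv` there is
`r ≠ 0` with `H¹(θ̂_r) y = 0` — the hypothesis `hSha` of `Specification.sur_of_dualSelmer_inputs` /
`sur_of_crk_caseC_tc_of_dualSha_torsion`.  Remaining bookkeeping inputs: `hurD` (the dual layers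
`Hom(𝐃[𝔪ᵏ], μ_{p^k})` are unramified outside `S`) and `hcard` (`#𝐃[𝔪ᵏ]` is supported on `S`), both
consequences of `p ∈ S` discharged by the assembler; `hinv`/`hUO` as in
`exists_ne_zero_scalar_mem_dualSha_of_mem_dualSelmer`. [cite: Greenberg2010, proof of Prop. 3.2.1 (p. 15 L19–21), §2.1 (6) p. 7]
[cite: MilneADT2006, Ch. I, Thm. 4.10 (a) and §4 p. 65] -/
theorem dualSha_torsion_of_poitouTateNatural [Finite (SigmaPlace S)] [CompactSpace (absoluteGaloisGroup K)]
    (hX : poitouTate_shaRestricted_tateDual_natural K)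
    (hurD : ∀ k, GaloisRep.IsUnramifiedOutside S ((torsionLayers ρ e hD).layerDualRep k))
    (hcard : ∀ (k : ℕ) (v : HeightOneSpectrum (𝓞 K)),
      ((Nat.card ↥(Submodule.torsionBySet Λ D ((maximalIdeal Λ ^ k : Ideal Λ) : Set Λ)) : ℕ) : 𝓞 K) ∈ v.asIdeal → v ∈ S)
    (inv : ∀ k : ℕ, LocalInvariants K (p ^ k))
    (hinv : ∀ v : Place K, InvLevelLaw inv v) (hUO : ∀ k, (inv k).UnramifiedOrthogonal)
    (hSp : ∀ w : HeightOneSpectrum (𝓞 K), ((p : ℕ) : 𝓞 K) ∈ w.asIdeal → w ∈ S)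
    (hLEO : LEO S ρ)
    (y : continuousCohomology 1 (torsionLayers ρ e hD).dualSystem.limitRep.toTopRep) (hy : y ∈ dualSha ρ e hD inv) :
    ∃ r : Λ, r ≠ 0 ∧ cohomologyMap (scalarDualEndHom ρ e hD r) 1 y = 0 := by
  haveI : ∀ k : ℕ, Finite ↥(Submodule.torsionBySet Λ D ((maximalIdeal Λ ^ k : Ideal Λ) : Set Λ)) := fun k => (torsionLayers ρ e hD).finite k
  obtain ⟨B, hP, hN⟩ := hX S
  -- the hypotheses of Milne I 4.10 (a) at each level
  have htor : ∀ (k : ℕ) (x : ↥(Submodule.torsionBySet Λ D ((maximalIdeal Λ ^ k : Ideal Λ) : Set Λ))), p ^ k • x = 0 := fun k x => by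
    apply Subtype.ext
    rw [Submodule.coe_smul_of_tower, Submodule.coe_zero, ← Nat.cast_smul_eq_nsmul Λ, Nat.cast_pow]
    exact (Submodule.mem_torsionBySet_iff _ _).1 x.2
      ⟨(p : Λ) ^ k, Ideal.pow_mem_pow (natCast_mem_maximalIdeal_of_ringEquiv_mvPowerSeries e) k⟩
  have hurM : ∀ k, GaloisRep.IsUnramifiedOutside S (toGaloisModule S (torsionLevelRep ρ k)) := fun k =>
    isUnramifiedOutside_toGaloisModule S _
  have hN' := fun k l => levelPairing_natural_of_fact ρ e hD B k l
    (hN (p ^ k) ↥(Submodule.torsionBySet Λ D ((maximalIdeal Λ ^ k : Ideal Λ) : Set Λ)) (toGaloisModule S (torsionLevelRep ρ k)) (p ^ l) ↥(Submodule.torsionBySet Λ D ((maximalIdeal Λ ^ l : Ideal Λ) : Set Λ)) (toGaloisModule S (torsionLevelRep ρ l))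
      (htor k) (hurM k) (hcard k) (htor l) (hurM l) (hcard l))
  have hP' := fun k => levelPairing_flip_injective_of_fact ρ e hD B k
    (hP (p ^ k) ↥(Submodule.torsionBySet Λ D ((maximalIdeal Λ ^ k : Ideal Λ) : Set Λ)) (toGaloisModule S (torsionLevelRep ρ k)) (htor k) (hurM k) (hcard k)).2.2.2
  exact dualSha_torsion_of_shaDualityTower ρ e hD inv hinv hUO hSp (towerPairing ρ e hD B hurD)
    ⟨fun h z => redHom_mem_shaOneDualLevel S (torsionLayers ρ e hD) h z.2,
      fun h x z => towerPairing_natural ρ e hD B hurD h (hN' _ _) x z⟩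
    (fun k z hz => towerPairing_nondegenerate ρ e hD B hurD k (hP' k) z hz)
    (fun r k x z => towerPairing_smul ρ e hD B hurD k r (hN' k k) x z) hLEO y hy

end Literature.NumberTheory.IwasawaTheory.Greenberg2016
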